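import Summits.Ventures.QEC.CircuitDistance.PortK2Bridge
import HarnessLib

/-!
# P3-PORT (K2b): CARD-5 Theorem 2 — translations, the pivot step, minimum weight and LIST COMPLETENESS from a
# passing K2 check (cell `qec`, experiment CDX, seat qec-cdx-type-1)

`K2Inst.k2_complete`: `check = true`, all cube runs `= true`, `H` and `rowSpace Hs` translation-covariant and every
`H`-kernel vector outside `rowSpace Hs` seen by a logical support ⇒ every nontrivial class word of `≤ w` generators is a
translate of a listed word.
-/

namespace Summit.Ventures.QEC.CircuitDistance

open Literature.InformationTheory.QuantumCodes Finset K2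

variable {ℓ m : ℕ}

namespace K2Inst

variable [NeZero ℓ] [NeZero m]
variable {I : K2Inst ℓ m} {H : BB.Mono ℓ m → (BB.Mono ℓ m ⊕ BB.Mono ℓ m) → ZMod 2}
  {words : List (List (Finset (BB.Mono ℓ m ⊕ BB.Mono ℓ m)))}

/-! ## Translations -/

/-- `trQ 0 = id`. -/
theorem trQ_zero' (s : Finset (BB.Mono ℓ m ⊕ BB.Mono ℓ m)) : trQ (0 : BB.Mono ℓ m) s = s := by
  ext q; rw [mem_trQ]
  rcases q with i | i
  · rw [translate_symm_inl, neg_zero, add_zero]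
  · rw [translate_symm_inr, neg_zero, add_zero]

/-- Translating back. -/
theorem trQ_neg_trQ (t : BB.Mono ℓ m) (s : Finset (BB.Mono ℓ m ⊕ BB.Mono ℓ m)) : trQ (-t) (trQ t s) = s := by
  rw [← trQ_add, add_neg_cancel, trQ_zero']

/-- Translating forth. -/
theorem trQ_trQ_neg (t : BB.Mono ℓ m) (s : Finset (BB.Mono ℓ m ⊕ BB.Mono ℓ m)) : trQ t (trQ (-t) s) = s := by
  rw [← trQ_add, neg_add_cancel, trQ_zero']

/-- `trQ t` is injective. -/
theorem trQ_injective (t : BB.Mono ℓ m) : Function.Injective (trQ t) := fun a b h => by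
  rw [← trQ_neg_trQ t a, h, trQ_neg_trQ]

/-- The vector of a translated class word is the translated vector. -/
theorem sum_indic_image_trQ (t : BB.Mono ℓ m) (x : Finset (Finset (BB.Mono ℓ m ⊕ BB.Mono ℓ m))) :
    (∑ g ∈ x.image (trQ t), indic g) = fun q => (∑ g ∈ x, indic g) ((BB.Code.translate t).symm q) := by
  rw [Finset.sum_image fun a _ b _ h => trQ_injective t h]
  funext q
  rw [Finset.sum_apply, Finset.sum_apply]
  apply Finset.sum_congr rfl; intro g _; rw [indic_trQ]

/-- CLOSURE of the generator list under translation by `t`, type preserved. -/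
def Cl (I : K2Inst ℓ m) (t : BB.Mono ℓ m) : Prop :=
  ∀ n < I.D.N, ∃ n' < I.D.N, I.G n' = trQ t (I.G n) ∧ n' / I.D.C = n / I.D.C

/-- Closure under `0`. -/
theorem cl_zero : I.Cl 0 := fun n hn => ⟨n, hn, by rw [trQ_zero'], rfl⟩

/-- Closure is additive. -/
theorem cl_add {a b : BB.Mono ℓ m} (ha : I.Cl a) (hb : I.Cl b) : I.Cl (a + b) := by
  intro n hn
  obtain ⟨n₁, hn₁, h₁, e₁⟩ := ha n hn
  obtain ⟨n₂, hn₂, h₂, e₂⟩ := hb n₁ hn₁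
  exact ⟨n₂, hn₂, by rw [trQ_add, ← h₁, h₂], by rw [e₂, e₁]⟩

open Fin.NatCast in
/-- Closure under the powers of `x`. -/
theorem cl_xpow (hx : I.Cl ((1 : Fin ℓ), (0 : Fin m))) : ∀ k : ℕ, I.Cl (((k : ℕ) : Fin ℓ), (0 : Fin m))
  | 0 => by rw [Nat.cast_zero]; exact cl_zero
  | k + 1 => by
    have : ((((k + 1 : ℕ) : ℕ) : Fin ℓ), (0 : Fin m)) = (((k : ℕ) : Fin ℓ), (0 : Fin m)) + ((1 : Fin ℓ), (0 : Fin m)) := by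
      rw [Prod.mk_add_mk, add_zero, Nat.cast_succ]
    rw [this]; exact cl_add (cl_xpow hx k) hx

open Fin.NatCast in
/-- Closure under the powers of `y`. -/
theorem cl_ypow (hy : I.Cl ((0 : Fin ℓ), (1 : Fin m))) : ∀ k : ℕ, I.Cl ((0 : Fin ℓ), ((k : ℕ) : Fin m))
  | 0 => by rw [Nat.cast_zero]; exact cl_zero
  | k + 1 => by
    have : ((0 : Fin ℓ), (((k + 1 : ℕ) : ℕ) : Fin m)) = ((0 : Fin ℓ), ((k : ℕ) : Fin m)) + ((0 : Fin ℓ), (1 : Fin m)) := by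
      rw [Prod.mk_add_mk, add_zero, Nat.cast_succ]
    rw [this]; exact cl_add (cl_ypow hy k) hy

open Fin.NatCast in
/-- Closure under every translation (from the two generators). -/
theorem cl_all (hg : I.Good H words) (t : BB.Mono ℓ m) : I.Cl t := by
  have hx : I.Cl ((1 : Fin ℓ), (0 : Fin m)) := hg.clos _ (by simp)
  have hy : I.Cl ((0 : Fin ℓ), (1 : Fin m)) := hg.clos _ (by simp)
  obtain ⟨a, b⟩ := t
  have e : ((a, b) : BB.Mono ℓ m) = (((a.val : ℕ) : Fin ℓ), (0 : Fin m)) + ((0 : Fin ℓ), ((b.val : ℕ) : Fin m)) := by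
    rw [Prod.mk_add_mk, add_zero, zero_add, Fin.cast_val_eq_self, Fin.cast_val_eq_self]
  rw [e]; exact cl_add (cl_xpow hx _) (cl_ypow hy _)

/-- Nontriviality is translation invariant (forward direction). -/
theorem nontriv_translate {Hs : Matrix (BB.Mono ℓ m) (BB.Mono ℓ m ⊕ BB.Mono ℓ m) (ZMod 2)}
    (hH : ∀ (v : BB.Mono ℓ m ⊕ BB.Mono ℓ m → ZMod 2) (t j : BB.Mono ℓ m),
      Matrix.mulVec H (fun q => v ((BB.Code.translate t).symm q)) j = Matrix.mulVec H v (j - t))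
    (hHs : ∀ (v : BB.Mono ℓ m ⊕ BB.Mono ℓ m → ZMod 2) (t : BB.Mono ℓ m),
      v ∈ rowSpace Hs → (fun q => v ((BB.Code.translate t).symm q)) ∈ rowSpace Hs)
    {v : BB.Mono ℓ m ⊕ BB.Mono ℓ m → ZMod 2} (hz : Matrix.mulVec H v = 0) (hn : v ∉ rowSpace Hs) (t : BB.Mono ℓ m) :
    Matrix.mulVec H (fun q => v ((BB.Code.translate t).symm q)) = 0 ∧
      (fun q => v ((BB.Code.translate t).symm q)) ∉ rowSpace Hs := by
  refine ⟨funext fun j => by rw [hH, hz]; rfl, fun h => hn ?_⟩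
  have := hHs _ (-t) h
  convert this using 1
  funext q
  rcases q with i | i
  · simp only [translate_symm_inl, neg_neg, add_neg_cancel_right]
  · simp only [translate_symm_inr, neg_neg, add_neg_cancel_right]

/-! ## The pivot step: translate the minimal-type generator to position 0 and run the cube -/

/-- PIVOT STEP.  For a non-empty zero-syndrome class word of `≤ w` generators: a translation `t`, a cube `k` and a stop
set `S` inside the index word of the translate, zero-syndrome, non-empty and `StopOK`. -/
theorem pivot_step (hg : I.Good H words)
    (hcubes : ∀ k < I.Ts.length, I.D.cube (I.Ts.getD k []) (I.D.C * k) (I.lives.getD k 0) = true)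
    (hH : ∀ (v : BB.Mono ℓ m ⊕ BB.Mono ℓ m → ZMod 2) (t j : BB.Mono ℓ m),
      Matrix.mulVec H (fun q => v ((BB.Code.translate t).symm q)) j = Matrix.mulVec H v (j - t))
    {x : Finset (Finset (BB.Mono ℓ m ⊕ BB.Mono ℓ m))} (hx : ∀ g ∈ x, g ∈ I.gsupp)
    (hz : Matrix.mulVec H (∑ g ∈ x, indic g) = 0) (hne : x.Nonempty) (hcard : x.card ≤ I.D.w) :
    ∃ t : BB.Mono ℓ m, ∃ k < I.Ts.length, ∃ S : Finset ℕ,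
      (∀ g ∈ x.image (trQ t), g ∈ I.gsupp) ∧ S ⊆ I.ixOf (x.image (trQ t)) ∧ S.Nonempty ∧ I.D.ZeroSyn S ∧
      I.D.StopOK (I.Ts.getD k []) S := by
  -- the minimal index
  have hixne : (I.ixOf x).Nonempty := by
    obtain ⟨g, hgx⟩ := hne
    obtain ⟨n, hn, rfl⟩ := exists_idx hg (hx g hgx)
    exact ⟨n, mem_ixOf.2 ⟨hn, hgx⟩⟩
  set n₀ := (I.ixOf x).min' hixne with hn₀def
  have hn₀ : n₀ ∈ I.ixOf x := Finset.min'_mem _ _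
  obtain ⟨hn₀N, hn₀x⟩ := mem_ixOf.1 hn₀
  set C := I.D.C
  set τ := n₀ / C
  have hτ : τ < I.Ts.length := by
    apply Nat.div_lt_of_lt_mul; rw [Nat.mul_comm, ← hg.hNK]; exact hn₀N
  obtain ⟨t, ht⟩ := hg.piv n₀ hn₀N
  have hcl := cl_all hg t
  -- the translate
  have hx' : ∀ g ∈ x.image (trQ t), g ∈ I.gsupp := by
    intro g hg'
    obtain ⟨g₁, hg₁, rfl⟩ := Finset.mem_image.1 hg'
    obtain ⟨n₁, hn₁, rfl⟩ := exists_idx hg (hx g₁ hg₁)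
    obtain ⟨n', hn', h', -⟩ := hcl n₁ hn₁
    rw [← h']; exact G_mem hg hn'
  have hixlt : ∀ n ∈ I.ixOf (x.image (trQ t)), n < I.D.N := fun n hn => (mem_ixOf.1 hn).1
  have hpN : C * τ < I.D.N := lt_of_le_of_lt (Nat.mul_div_le n₀ C) hn₀N
  have hp : C * τ ∈ I.ixOf (x.image (trQ t)) := by
    rw [mem_ixOf]; refine ⟨hpN, ?_⟩
    rw [← ht]; exact Finset.mem_image_of_mem _ hn₀x
  have hlive : ∀ n ∈ I.ixOf (x.image (trQ t)), n ≠ C * τ → (I.lives.getD τ 0).testBit n = true := by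
    intro n hn hne'
    obtain ⟨hnN, hnx⟩ := mem_ixOf.1 hn
    rw [hg.live τ hτ n hnN]
    obtain ⟨g₁, hg₁, hg₁'⟩ := Finset.mem_image.1 hnx
    obtain ⟨n₁, hn₁, rfl⟩ := exists_idx hg (hx g₁ hg₁)
    obtain ⟨n₂, hn₂, h₂, e₂⟩ := hcl n₁ hn₁
    have h21 : n₂ = n := G_inj hg hn₂ hnN (by rw [h₂, hg₁'])
    have hle : n₀ ≤ n₁ := Finset.min'_le _ _ (mem_ixOf.2 ⟨hn₁, hg₁⟩)
    have hτle : τ ≤ n / C := by rw [← h21, e₂]; exact Nat.div_le_div_right hle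
    have : C * τ ≤ n := le_trans (Nat.mul_le_mul_left C hτle) (Nat.mul_div_le n C)
    rw [decide_eq_true this, beq_false_of_ne hne']; rfl
  have hcard' : (I.ixOf (x.image (trQ t))).card ≤ I.D.w := by
    rw [card_ixOf hg hx', Finset.card_image_of_injective _ (trQ_injective t)]; exact hcard
  have hzs' : I.D.ZeroSyn (I.ixOf (x.image (trQ t))) := by
    rw [zeroSyn_iff hg hixlt, vecOf_ixOf hg hx', sum_indic_image_trQ]
    funext j; rw [hH, hz]; rfl
  obtain ⟨S, hpS, hS, hSz, hstop⟩ :=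
    I.D.cube_sound hg.wf _ _ _ (hcubes τ hτ) _ hixlt hzs' hp hcard' hlive
  exact ⟨t, τ, hτ, S, hx', hS, ⟨_, hpS⟩, hSz, hstop⟩


/-! ## CARD-5 Theorem 2: minimum weight and list completeness -/

section Main

variable {Hs : Matrix (BB.Mono ℓ m) (BB.Mono ℓ m ⊕ BB.Mono ℓ m) (ZMod 2)}

/-- **(hmin)** every nontrivial class word has at least `w − 1` generators. -/
theorem w_le_card_succ (hg : I.Good H words)
    (hcubes : ∀ k < I.Ts.length, I.D.cube (I.Ts.getD k []) (I.D.C * k) (I.lives.getD k 0) = true)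
    (hH : ∀ (v : BB.Mono ℓ m ⊕ BB.Mono ℓ m → ZMod 2) (t j : BB.Mono ℓ m),
      Matrix.mulVec H (fun q => v ((BB.Code.translate t).symm q)) j = Matrix.mulVec H v (j - t))
    (hHs : ∀ (v : BB.Mono ℓ m ⊕ BB.Mono ℓ m → ZMod 2) (t : BB.Mono ℓ m),
      v ∈ rowSpace Hs → (fun q => v ((BB.Code.translate t).symm q)) ∈ rowSpace Hs)
    (hlog : ∀ v, Matrix.mulVec H v = 0 → v ∉ rowSpace Hs → ∃ s ∈ I.lsupp, indic s ⬝ᵥ v ≠ 0) :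
    ∀ (v : ℕ) (x : Finset (Finset (BB.Mono ℓ m ⊕ BB.Mono ℓ m))), x.card = v → (∀ g ∈ x, g ∈ I.gsupp) →
      Matrix.mulVec H (∑ g ∈ x, indic g) = 0 → (∑ g ∈ x, indic g) ∉ rowSpace Hs → I.D.w ≤ x.card + 1 := by
  intro v
  induction v using Nat.strong_induction_on with
  | _ v ih =>
  intro x hv hx hz hn
  by_contra hlt
  have hne : x.Nonempty := by
    rw [Finset.nonempty_iff_ne_empty]; rintro rfl; apply hn; rw [Finset.sum_empty]; exact Submodule.zero_mem _
  obtain ⟨t, k, _, S, hx', hS, hSne, hSz, hstop⟩ := pivot_step hg hcubes hH hx hz hne (by omega)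
  have hcardx' : (x.image (trQ t)).card = v := by rw [Finset.card_image_of_injective _ (trQ_injective t), hv]
  have hixS : ∀ n ∈ S, n < I.D.N := fun n hn' => (mem_ixOf.1 (hS hn')).1
  rcases hstop with hl | ⟨hwS, -⟩
  · -- trivial stop: remove its image from the translate and recurse
    have hyx : S.image I.G ⊆ x.image (trQ t) := fun g hg' => by
      obtain ⟨n, hn', rfl⟩ := Finset.mem_image.1 hg'; exact (mem_ixOf.1 (hS hn')).2
    have hycard : (S.image I.G).card = S.card := Finset.card_image_of_injOn (G_injOn hg hixS)
    have hS3 : 3 ≤ S.card := I.D.three_le_card_of_zeroSyn hg.z0 hixS hSz hSne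
    have hyrs : (∑ g ∈ S.image I.G, indic g) ∈ rowSpace Hs := by
      rw [← vecOf_eq_sum_image hg hixS]; exact mem_rowSpace_of_lgZero hg hlog hixS hSz hl
    have hyz : Matrix.mulVec H (∑ g ∈ S.image I.G, indic g) = 0 := by
      rw [← vecOf_eq_sum_image hg hixS]; exact (zeroSyn_iff hg hixS).1 hSz
    have hsum : (∑ g ∈ x.image (trQ t) \ S.image I.G, indic g) =
        (∑ g ∈ x.image (trQ t), indic g) - ∑ g ∈ S.image I.G, indic g := by
      rw [eq_sub_iff_add_eq, Finset.sum_sdiff hyx]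
    have hx'z := nontriv_translate hH hHs hz hn t
    rw [← sum_indic_image_trQ] at hx'z
    have h1 : Matrix.mulVec H (∑ g ∈ x.image (trQ t) \ S.image I.G, indic g) = 0 := by
      rw [hsum, Matrix.mulVec_sub, hx'z.1, hyz, sub_zero]
    have h2 : (∑ g ∈ x.image (trQ t) \ S.image I.G, indic g) ∉ rowSpace Hs := fun h => hx'z.2 (by
      have := Submodule.add_mem _ h hyrs; rwa [hsum, sub_add_cancel] at this)
    have hc := Finset.card_sdiff_add_card_eq_card hyx
    rw [hycard, hcardx'] at hc
    have := ih _ (by omega) (x.image (trQ t) \ S.image I.G) rfl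
      (fun g hg' => hx' g (Finset.mem_sdiff.1 hg').1) h1 h2
    omega
  · have : S.card ≤ v := (Finset.card_le_card hS).trans (by rw [card_ixOf hg hx', hcardx'])
    omega

/-- **CARD-5 THEOREM 2 (LIST COMPLETENESS from a passing K2 check).** -/
theorem k2_complete (hchk : I.check H words = true)
    (hcubes : ∀ k < I.Ts.length, I.D.cube (I.Ts.getD k []) (I.D.C * k) (I.lives.getD k 0) = true)
    (hH : ∀ (v : BB.Mono ℓ m ⊕ BB.Mono ℓ m → ZMod 2) (t j : BB.Mono ℓ m),
      Matrix.mulVec H (fun q => v ((BB.Code.translate t).symm q)) j = Matrix.mulVec H v (j - t))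
    (hHs : ∀ (v : BB.Mono ℓ m ⊕ BB.Mono ℓ m → ZMod 2) (t : BB.Mono ℓ m),
      v ∈ rowSpace Hs → (fun q => v ((BB.Code.translate t).symm q)) ∈ rowSpace Hs)
    (hlog : ∀ v, Matrix.mulVec H v = 0 → v ∉ rowSpace Hs → ∃ s ∈ I.lsupp, indic s ⬝ᵥ v ≠ 0)
    (x : Finset (Finset (BB.Mono ℓ m ⊕ BB.Mono ℓ m))) (hx : ∀ g ∈ x, g ∈ I.gsupp)
    (hz : Matrix.mulVec H (∑ g ∈ x, indic g) = 0) (hn : (∑ g ∈ x, indic g) ∉ rowSpace Hs)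
    (hcard : x.card ≤ I.D.w) :
    ∃ wd ∈ words, ∃ t : BB.Mono ℓ m, x = (wd.map (trQ t)).toFinset := by
  have hg := good_of_check I H words hchk
  have hne : x.Nonempty := by
    rw [Finset.nonempty_iff_ne_empty]; rintro rfl; apply hn; rw [Finset.sum_empty]; exact Submodule.zero_mem _
  obtain ⟨t, k, hk, S, hx', hS, hSne, hSz, hstop⟩ := pivot_step hg hcubes hH hx hz hne hcard
  have hcardx' : (x.image (trQ t)).card = x.card := Finset.card_image_of_injective _ (trQ_injective t)
  have hixlt : ∀ n ∈ I.ixOf (x.image (trQ t)), n < I.D.N := fun n hn' => (mem_ixOf.1 hn').1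
  have hixS : ∀ n ∈ S, n < I.D.N := fun n hn' => hixlt n (hS hn')
  have hx'z := nontriv_translate hH hHs hz hn t
  rw [← sum_indic_image_trQ] at hx'z
  have hS3 : 3 ≤ S.card := I.D.three_le_card_of_zeroSyn hg.z0 hixS hSz hSne
  rcases hstop with hl | ⟨hwS, msk, hmsk, hmask⟩
  · exfalso
    have hyx : S.image I.G ⊆ x.image (trQ t) := fun g hg' => by
      obtain ⟨n, hn', rfl⟩ := Finset.mem_image.1 hg'; exact (mem_ixOf.1 (hS hn')).2
    have hycard : (S.image I.G).card = S.card := Finset.card_image_of_injOn (G_injOn hg hixS)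
    have hyrs : (∑ g ∈ S.image I.G, indic g) ∈ rowSpace Hs := by
      rw [← vecOf_eq_sum_image hg hixS]; exact mem_rowSpace_of_lgZero hg hlog hixS hSz hl
    have hyz : Matrix.mulVec H (∑ g ∈ S.image I.G, indic g) = 0 := by
      rw [← vecOf_eq_sum_image hg hixS]; exact (zeroSyn_iff hg hixS).1 hSz
    have hsum : (∑ g ∈ x.image (trQ t) \ S.image I.G, indic g) =
        (∑ g ∈ x.image (trQ t), indic g) - ∑ g ∈ S.image I.G, indic g := by
      rw [eq_sub_iff_add_eq, Finset.sum_sdiff hyx]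
    have h1 : Matrix.mulVec H (∑ g ∈ x.image (trQ t) \ S.image I.G, indic g) = 0 := by
      rw [hsum, Matrix.mulVec_sub, hx'z.1, hyz, sub_zero]
    have h2 : (∑ g ∈ x.image (trQ t) \ S.image I.G, indic g) ∉ rowSpace Hs := fun h => hx'z.2 (by
      have := Submodule.add_mem _ h hyrs; rwa [hsum, sub_add_cancel] at this)
    have hc := Finset.card_sdiff_add_card_eq_card hyx
    rw [hycard, hcardx'] at hc
    have := w_le_card_succ hg hcubes hH hHs hlog _ (x.image (trQ t) \ S.image I.G) rfl
      (fun g hg' => hx' g (Finset.mem_sdiff.1 hg').1) h1 h2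
    have : S.card ≤ x.card := (Finset.card_le_card hS).trans (by rw [card_ixOf hg hx', hcardx'])
    omega
  · -- the stop set is the whole index word
    have hzs' : I.D.ZeroSyn (I.ixOf (x.image (trQ t))) := by
      rw [zeroSyn_iff hg hixlt, vecOf_ixOf hg hx']; exact hx'z.1
    have hSeq : S = I.ixOf (x.image (trQ t)) := by
      by_contra hne'
      have hdne : (I.ixOf (x.image (trQ t)) \ S).Nonempty := by
        rw [Finset.sdiff_nonempty]; exact fun h => hne' (Finset.Subset.antisymm hS h)
      have h3 := I.D.three_le_card_of_zeroSyn hg.z0 (fun n hn' => hixlt n (Finset.mem_sdiff.1 hn').1)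
        (I.D.zeroSyn_sdiff hS hzs' hSz) hdne
      have hc := Finset.card_sdiff_add_card_eq_card hS
      rw [card_ixOf hg hx', hcardx'] at hc
      omega
    obtain ⟨e, he, t₁, hwg, hbits⟩ := hg.wit_ok k hk msk hmsk
    have hx'eq : ∀ g, g ∈ x.image (trQ t) ↔ g ∈ (words.getD e []).map (trQ t₁) := by
      intro g
      constructor
      · intro hg'
        obtain ⟨n, hn', rfl⟩ := exists_idx hg (hx' g hg')
        have hnS : n ∈ S := by rw [hSeq]; exact mem_ixOf.2 ⟨hn', hg'⟩
        have := hmask n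
        rw [hbits n hn', decide_eq_true hnS, decide_eq_true_iff] at this
        exact this
      · intro hg'
        obtain ⟨n, hn', rfl⟩ := exists_idx hg (hwg _ hg')
        have := hmask n
        rw [hbits n hn', decide_eq_true hg'] at this
        have hnS : n ∈ S := of_decide_eq_true this.symm
        rw [hSeq] at hnS
        exact (mem_ixOf.1 hnS).2
    refine ⟨words.getD e [], ?_, t₁ + -t, ?_⟩
    · rw [List.getD_eq_getElem _ _ he]; exact List.getElem_mem he
    · ext g
      rw [List.mem_toFinset, List.mem_map]
      constructor
      · intro hgx
        have : trQ t g ∈ (words.getD e []).map (trQ t₁) := (hx'eq _).1 (Finset.mem_image_of_mem _ hgx)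
        obtain ⟨a, ha, hag⟩ := List.mem_map.1 this
        exact ⟨a, ha, by rw [trQ_add, hag, trQ_neg_trQ]⟩
      · rintro ⟨a, ha, rfl⟩
        have : trQ t₁ a ∈ x.image (trQ t) := (hx'eq _).2 (List.mem_map.2 ⟨a, ha, rfl⟩)
        obtain ⟨g₁, hg₁, hg₁'⟩ := Finset.mem_image.1 this
        rw [trQ_add, ← hg₁', trQ_neg_trQ]; exact hg₁

end Main

end K2Inst

/-! ## Row spaces of `H^X`, `H^Z` are translation invariant -/

section RowSpace

variable [NeZero ℓ] [NeZero m]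

/-- `rowSpace H^X` is translation invariant. -/
theorem rowSpace_HX_translate (S : SMCode ℓ m) (v : BB.Mono ℓ m ⊕ BB.Mono ℓ m → ZMod 2) (t : BB.Mono ℓ m)
    (hv : v ∈ rowSpace S.toCode.HX) : (fun q => v ((BB.Code.translate t).symm q)) ∈ rowSpace S.toCode.HX := by
  rw [mem_rowSpace_iff] at hv ⊢
  obtain ⟨c, rfl⟩ := hv
  refine ⟨fun i => c (i - t), funext fun q => ?_⟩
  simp only [Matrix.vecMul, dotProduct]
  rw [← Equiv.sum_comp (Equiv.addRight t)]
  apply Finset.sum_congr rfl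
  intro i _
  simp only [Equiv.coe_addRight, add_sub_cancel_right]
  congr 1
  have := BB.Code.HX_translate S.toCode t i ((BB.Code.translate t).symm q)
  rw [Equiv.apply_symm_apply] at this
  exact this

/-- `rowSpace H^Z` is translation invariant. -/
theorem rowSpace_HZ_translate (S : SMCode ℓ m) (v : BB.Mono ℓ m ⊕ BB.Mono ℓ m → ZMod 2) (t : BB.Mono ℓ m)
    (hv : v ∈ rowSpace S.toCode.HZ) : (fun q => v ((BB.Code.translate t).symm q)) ∈ rowSpace S.toCode.HZ := by
  rw [mem_rowSpace_iff] at hv ⊢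
  obtain ⟨c, rfl⟩ := hv
  refine ⟨fun i => c (i - t), funext fun q => ?_⟩
  simp only [Matrix.vecMul, dotProduct]
  rw [← Equiv.sum_comp (Equiv.addRight t)]
  apply Finset.sum_congr rfl
  intro i _
  simp only [Equiv.coe_addRight, add_sub_cancel_right]
  congr 1
  have := BB.Code.HZ_translate S.toCode t i ((BB.Code.translate t).symm q)
  rw [Equiv.apply_symm_apply] at this
  exact this

end RowSpace

end Summit.Ventures.QEC.CircuitDistance
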